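import Mathlib
import Literature.NumberTheory.LFunctions.Zhang2022.Section16Lemma162RModel
import HarnessLib

/-!
# Zhang (2022) §16 Lemma 16.2 at the repaired normaliser (GAP row G-d57-1), part 7: the prime `2`

Topic `Literature/NumberTheory/LFunctions/Zhang2022` (Landau–Siegel audit tree; verdict-neutral).
Y. Zhang, *Discrete mean estimates and the Landau–Siegel zero*, arXiv:2211.02515v1 (2022)
[Zhang2022LandauSiegel] — **an unrefereed manuscript under adjudication; nothing here asserts or denies
its Theorems 1–2.** ZHANG-L WP16 block D, sub-leaf `Typed.Section16B.Lemma162R`. Theorems only.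

The global coefficient `ϖ₂ⱼ(2^e)` (the lane's reading F16B-1: `ϖ₂ⱼ(1) = 𝓜₂(1,1)/𝓜₂* ≠ 1` when `χ(2) = 1`):
* **structure**: `ϖ₂ⱼ(2^e) = (Σ_{a≤e} λ₂(2^a)(2^a)^{β_j}χ(2)^{e−a}F₂(2^a,2^{e−a};1−β_j)) / c₂`,
  `c₂ = F₂(1,1;1−β_j)` if `χ(2) ≠ 1`, `c₂ = 2` if `χ(2) = 1` (the odd Euler factors of `𝓜₂(2^a,2^b;·)` and of
  `𝓜₂*` coincide and cancel; `varpi2_two_pow_eq`), valid whenever `𝓜₂*(1−β_j) ≠ 0`;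
* hence (H2) `‖ϖ₂ⱼ(2^e)‖ ≤ 2100(e+1)` when `|c₂| ≥ 1/2`, and `ϖ₂ⱼ(2^e) = ϖ₂ⱼ^loc(2^e)` when `χ(2) ≠ 1`;
* for `χ(2) = 1`: the Euler factor of `E₂ⱼ` at `2`, `s = 1`, is within `6·10⁸·δ₂` of
  `(1/2)⁶·Σ_e e·C(e+2,2)·2^{−e} = 3/8 = (1 − 1/4)/2` (`norm_Phi_two_one_sub_model_le`) — the factor of
  `(6/π²)/𝔭` at `2` in the case `𝔭 = 2∏_{q>2}(…)` of Lemma 16.1.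

## References

* Y. Zhang, arXiv:2211.02515v1 (2022), §16 pp. 92–94 (Lemma 16.1, (16.13), Lemma 16.2); App. A p. 106.
  [cite: Zhang2022LandauSiegel, §16 Lemma 16.2 p.94]
-/

noncomputable section

open Complex Real Finset Filter Topology

namespace Literature.NumberTheory.LFunctions.Zhang2022.Lemma162R

open Literature.NumberTheory.LFunctions.Zhang2022
open Literature.NumberTheory.LFunctions.Zhang2022.Skeleton
open Literature.NumberTheory.LFunctions.Zhang2022.Typed.Section16A
open Literature.NumberTheory.LFunctions.Zhang2022.Typed.Section16B
open Literature.NumberTheory.LFunctions.Zhang2022.AppendixA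

/-! ## §0. Series lemmas (private copies) -/

section Series

/-- `(e+1)(e+2)(e+3) = 6·C(e+3,3)`. [folklore] -/
private theorem choose_three_mul_six'' (e : ℕ) : 6 * (e + 3).choose 3 = (e + 1) * (e + 2) * (e + 3) := by
  have h := Nat.choose_mul_factorial_mul_factorial (show 3 ≤ e + 3 by omega)
  rw [show e + 3 - 3 = e from by omega] at h
  have h3 : (3 : ℕ).factorial = 6 := by decide
  have hf : (e + 3).factorial = (e + 1) * (e + 2) * (e + 3) * e.factorial := by
    rw [show e + 3 = (e + 2) + 1 from rfl, Nat.factorial_succ, show e + 2 = (e + 1) + 1 from rfl,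
      Nat.factorial_succ, Nat.factorial_succ]; ring
  rw [h3, hf] at h
  have he : 0 < e.factorial := Nat.factorial_pos e
  apply Nat.eq_of_mul_eq_mul_right he
  calc 6 * (e + 3).choose 3 * e.factorial = (e + 3).choose 3 * 6 * e.factorial := by ring
    _ = (e + 1) * (e + 2) * (e + 3) * e.factorial := h

/-- `(e+1)³ ≤ 6·C(e+3,3)` and `(e+3)³ ≤ 27·C(e+3,3)` (as reals). [folklore] -/
private theorem cube_le_choose'' (e : ℕ) :
    ((e : ℝ) + 1) ^ 3 ≤ 6 * ((e + 3).choose 3 : ℝ) ∧ ((e : ℝ) + 3) ^ 3 ≤ 27 * ((e + 3).choose 3 : ℝ) := by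
  have h : (6 : ℝ) * ((e + 3).choose 3 : ℝ) = ((e : ℝ) + 1) * ((e : ℝ) + 2) * ((e : ℝ) + 3) := by
    exact_mod_cast choose_three_mul_six'' e
  have he : (0 : ℝ) ≤ e := Nat.cast_nonneg e
  constructor
  · rw [h]; nlinarith [mul_nonneg he he, mul_nonneg (mul_nonneg he he) he]
  · rw [show (27 : ℝ) * ((e + 3).choose 3 : ℝ) = 9 / 2 * (6 * ((e + 3).choose 3 : ℝ)) by ring, h]
    nlinarith [mul_nonneg he he, mul_nonneg (mul_nonneg he he) he]

/-- For `0 ≤ r < 1`: `Σ_e C(e+3,3) rᵉ = (1−r)⁻⁴` is summable with that value. [folklore] -/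
private theorem hasSum_choose_three'' {r : ℝ} (hr0 : 0 ≤ r) (hr : r < 1) :
    HasSum (fun e : ℕ => ((e + 3).choose 3 : ℝ) * r ^ e) (1 / (1 - r) ^ 4) := by
  have h := hasSum_choose_mul_geometric_of_norm_lt_one 3 (r := r) (by rw [Real.norm_eq_abs, abs_of_nonneg hr0]; exact hr)
  simpa using h

/-- **Summability**: `|c_e| ≤ M(e+1)³`, `‖y‖ < 1` ⇒ `Σ c_e yᵉ` converges absolutely. [folklore] -/
private theorem summable_norm_coeff_mul_pow'' {c : ℕ → ℂ} {M : ℝ} (hc : ∀ e, ‖c e‖ ≤ M * ((e : ℝ) + 1) ^ 3)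
    {y : ℂ} (hy : ‖y‖ < 1) : Summable fun e : ℕ => ‖c e * y ^ e‖ := by
  have hM : 0 ≤ M := by have := hc 0; simp at this; linarith [norm_nonneg (c 0)]
  have hs := ((hasSum_choose_three'' (norm_nonneg y) hy).summable.mul_left (6 * M))
  refine Summable.of_nonneg_of_le (fun _ => norm_nonneg _) (fun e => ?_) hs
  rw [norm_mul, norm_pow]
  have h1 := (cube_le_choose'' e).1
  calc ‖c e‖ * ‖y‖ ^ e ≤ (M * ((e : ℝ) + 1) ^ 3) * ‖y‖ ^ e := by gcongr; exact hc e
    _ ≤ (M * (6 * ((e + 3).choose 3 : ℝ))) * ‖y‖ ^ e := by gcongr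
    _ = 6 * M * (((e + 3).choose 3 : ℝ) * ‖y‖ ^ e) := by ring

/-- Termwise majorant: `‖c_e yᵉ‖ ≤ 6M·C(e+3,3)‖y‖ᵉ`. [folklore] -/
private theorem norm_coeff_mul_pow_le'' {c : ℕ → ℂ} {M : ℝ} (hc : ∀ e, ‖c e‖ ≤ M * ((e : ℝ) + 1) ^ 3)
    (y : ℂ) (e : ℕ) : ‖c e * y ^ e‖ ≤ 6 * M * (((e + 3).choose 3 : ℝ) * ‖y‖ ^ e) := by
  have hM : 0 ≤ M := by have := hc 0; simp at this; linarith [norm_nonneg (c 0)]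
  rw [norm_mul, norm_pow]
  have h1 := (cube_le_choose'' e).1
  have h2 : ‖c e‖ ≤ M * (6 * ((e + 3).choose 3 : ℝ)) := (hc e).trans (by gcongr)
  have h3 : 0 ≤ ‖y‖ ^ e := pow_nonneg (norm_nonneg _) e
  calc ‖c e‖ * ‖y‖ ^ e ≤ (M * (6 * ((e + 3).choose 3 : ℝ))) * ‖y‖ ^ e := mul_le_mul_of_nonneg_right h2 h3
    _ = 6 * M * (((e + 3).choose 3 : ℝ) * ‖y‖ ^ e) := by ring

/-- `1/(1−r)⁴ ≤ 40` for `0 ≤ r ≤ 3/5`. [folklore] -/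
private theorem one_div_pow_four_le'' {r : ℝ} (hr : r ≤ 3 / 5) : 1 / (1 - r) ^ 4 ≤ 40 := by
  have h25 : (2 / 5 : ℝ) ≤ 1 - r := by linarith
  have hpow : (2 / 5 : ℝ) ^ 4 ≤ (1 - r) ^ 4 := pow_le_pow_left₀ (by norm_num) h25 4
  rw [div_le_iff₀ (lt_of_lt_of_le (by norm_num) hpow)]
  nlinarith

/-- **Size**: `|c_e| ≤ M(e+1)³`, `‖y‖ ≤ 3/5` ⇒ `‖Σ c_e yᵉ‖ ≤ 240M` (`6M/(1−‖y‖)⁴ ≤ 240M`). [folklore] -/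
private theorem norm_tsum_coeff_mul_pow_le'' {c : ℕ → ℂ} {M : ℝ} (hc : ∀ e, ‖c e‖ ≤ M * ((e : ℝ) + 1) ^ 3)
    {y : ℂ} (hy : ‖y‖ ≤ 3 / 5) : ‖∑' e : ℕ, c e * y ^ e‖ ≤ 240 * M := by
  have hM : 0 ≤ M := by have := hc 0; simp at this; linarith [norm_nonneg (c 0)]
  have hy1 : ‖y‖ < 1 := by linarith
  have hS := hasSum_choose_three'' (norm_nonneg y) hy1
  have hsum := summable_norm_coeff_mul_pow'' hc hy1
  have hmaj : Summable fun e : ℕ => 6 * M * (((e + 3).choose 3 : ℝ) * ‖y‖ ^ e) := hS.summable.mul_left _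
  have h1 : ‖∑' e : ℕ, c e * y ^ e‖ ≤ ∑' e : ℕ, ‖c e * y ^ e‖ := norm_tsum_le_tsum_norm hsum
  have h2 : ∑' e : ℕ, ‖c e * y ^ e‖ ≤ ∑' e : ℕ, 6 * M * (((e + 3).choose 3 : ℝ) * ‖y‖ ^ e) :=
    Summable.tsum_le_tsum (fun e => norm_coeff_mul_pow_le'' hc y e) hsum hmaj
  have h3 : ∑' e : ℕ, 6 * M * (((e + 3).choose 3 : ℝ) * ‖y‖ ^ e) = 6 * M * (1 / (1 - ‖y‖) ^ 4) := by
    rw [tsum_mul_left, hS.tsum_eq]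
  have h4 := one_div_pow_four_le'' hy
  have h5 : 6 * M * (1 / (1 - ‖y‖) ^ 4) ≤ 6 * M * 40 := mul_le_mul_of_nonneg_left h4 (by positivity)
  have h6 : ‖∑' e : ℕ, c e * y ^ e‖ ≤ 6 * M * 40 := (h1.trans h2).trans (h3.le.trans h5)
  have h7 : (6 : ℝ) * M * 40 = 240 * M := by ring
  rw [h7] at h6
  exact h6

/-- `(e+1)(e+2)(e+3)(e+4) = 24·C(e+4,4)`. [folklore] -/
private theorem choose_four_mul' (e : ℕ) : 24 * (e + 4).choose 4 = (e + 1) * (e + 2) * (e + 3) * (e + 4) := by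
  have h := Nat.choose_mul_factorial_mul_factorial (show 4 ≤ e + 4 by omega)
  rw [show e + 4 - 4 = e from by omega] at h
  have h4 : (4 : ℕ).factorial = 24 := by decide
  have hf : (e + 4).factorial = (e + 1) * (e + 2) * (e + 3) * (e + 4) * e.factorial := by
    rw [show e + 4 = (e + 3) + 1 from rfl, Nat.factorial_succ, show e + 3 = (e + 2) + 1 from rfl,
      Nat.factorial_succ, show e + 2 = (e + 1) + 1 from rfl, Nat.factorial_succ, Nat.factorial_succ]; ring
  rw [h4, hf] at h
  have he : 0 < e.factorial := Nat.factorial_pos e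
  apply Nat.eq_of_mul_eq_mul_right he
  calc 24 * (e + 4).choose 4 * e.factorial = (e + 4).choose 4 * 24 * e.factorial := by ring
    _ = (e + 1) * (e + 2) * (e + 3) * (e + 4) * e.factorial := h

/-- `(e+2)⁴ ≤ 16·24·C(e+4,4)` (as reals). [folklore] -/
private theorem quartic_le_choose' (e : ℕ) : ((e : ℝ) + 2) ^ 4 ≤ 384 * ((e + 4).choose 4 : ℝ) := by
  have h : (24 : ℝ) * ((e + 4).choose 4 : ℝ) = ((e : ℝ) + 1) * ((e : ℝ) + 2) * ((e : ℝ) + 3) * ((e : ℝ) + 4) := by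
    exact_mod_cast choose_four_mul' e
  have he : (0 : ℝ) ≤ e := Nat.cast_nonneg e
  rw [show (384 : ℝ) * ((e + 4).choose 4 : ℝ) = 16 * (24 * ((e + 4).choose 4 : ℝ)) by ring, h]
  nlinarith [mul_nonneg he he, mul_nonneg (mul_nonneg he he) he, mul_nonneg (mul_nonneg (mul_nonneg he he) he) he,
    pow_nonneg he 4]

/-- `Σ_e (e+2)⁴ 2^{−e} ≤ 12288`. [folklore] -/
private theorem tsum_quartic_half_le' :
    Summable (fun e : ℕ => ((e : ℝ) + 2) ^ 4 * (1 / 2 : ℝ) ^ e) ∧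
      ∑' e : ℕ, ((e : ℝ) + 2) ^ 4 * (1 / 2 : ℝ) ^ e ≤ 12288 := by
  have hS := hasSum_choose_mul_geometric_of_norm_lt_one 4 (r := (1 / 2 : ℝ)) (by norm_num)
  have hS' : HasSum (fun e : ℕ => ((e + 4).choose 4 : ℝ) * (1 / 2 : ℝ) ^ e) 32 := by
    have h32 : (1 : ℝ) / (1 - 1 / 2) ^ (4 + 1) = 32 := by norm_num
    rw [← h32]; exact hS
  have hmaj : Summable fun e : ℕ => 384 * (((e + 4).choose 4 : ℝ) * (1 / 2 : ℝ) ^ e) := hS'.summable.mul_left _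
  have hle : ∀ e : ℕ, ((e : ℝ) + 2) ^ 4 * (1 / 2 : ℝ) ^ e ≤ 384 * (((e + 4).choose 4 : ℝ) * (1 / 2 : ℝ) ^ e) := by
    intro e
    rw [← mul_assoc]
    exact mul_le_mul_of_nonneg_right (quartic_le_choose' e) (by positivity)
  have hsum : Summable (fun e : ℕ => ((e : ℝ) + 2) ^ 4 * (1 / 2 : ℝ) ^ e) :=
    Summable.of_nonneg_of_le (fun e => by positivity) hle hmaj
  refine ⟨hsum, ?_⟩
  calc _ ≤ ∑' e : ℕ, 384 * (((e + 4).choose 4 : ℝ) * (1 / 2 : ℝ) ^ e) := Summable.tsum_le_tsum hle hsum hmaj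
    _ = 384 * 32 := by rw [tsum_mul_left, hS'.tsum_eq]
    _ = 12288 := by norm_num

end Series

/-! ## §1. Splitting the Euler product of `𝓜₂(2^a,2^b;s)` at the prime `2` -/

section Split

variable (c' : ℝ) {D : ℕ} (χ : DirichletCharacter ℂ D) (j : ℕ)

/-- **`𝓜₂(2^a,2^b;s) = F₂(2^a,2^b;s) · M₀(s)`**, `M₀(s) = ∏'_q (q = 2 ? 1 : F_q(1,1;s))`, for `σ ≥ 9/10`
(the Euler factors at odd `q` do not see the powers of `2`: locality `calM2Factor_eq_one_one_of_coprime`;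
the product of the odd factors converges by `summable_norm_calM2Factor_one_one_sub_one`).
[cite: Zhang2022LandauSiegel, §16 p.91 (u021), p.93] -/
theorem calM2_two_pow_eq (a b : ℕ) {s : ℂ} (hs : 9 / 10 ≤ s.re) :
    calM2 c' χ (2 ^ a) (2 ^ b) s = calM2Factor c' χ 2 (2 ^ a) (2 ^ b) s *
      ∏' q : Nat.Primes, (if (q : ℕ) = 2 then (1 : ℂ) else calM2Factor c' χ (q : ℕ) 1 1 s) := by
  classical
  have hs0 : 0 < s.re := by linarith
  set g : Nat.Primes → ℂ := fun q => if (q : ℕ) = 2 then (1 : ℂ) else calM2Factor c' χ (q : ℕ) 1 1 s with hg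
  -- `g` is multipliable
  have hgsum : Summable fun q : Nat.Primes => ‖g q - 1‖ := by
    refine Summable.of_nonneg_of_le (fun _ => norm_nonneg _) (fun q => ?_)
      (summable_norm_calM2Factor_one_one_sub_one c' χ hs)
    simp only [hg]
    split_ifs
    · simp
    · exact le_rfl
  have hgm : Multipliable g := by
    have h := multipliable_one_add_of_summable hgsum
    simpa only [add_sub_cancel] using h
  have hG : HasProd g (∏' q, g q) := hgm.hasProd
  -- the single factor at `2`
  have h2 : HasProd (fun q : Nat.Primes => if (q : ℕ) = 2 then calM2Factor c' χ 2 (2 ^ a) (2 ^ b) s else 1)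
      (calM2Factor c' χ 2 (2 ^ a) (2 ^ b) s) := by
    have h := hasProd_single (f := fun q : Nat.Primes => if (q : ℕ) = 2 then calM2Factor c' χ 2 (2 ^ a) (2 ^ b) s else 1)
      (⟨2, Nat.prime_two⟩ : Nat.Primes) (fun q hq => by
        rw [if_neg]
        intro h2
        exact hq (Subtype.ext h2))
    simpa using h
  have hprod := h2.mul hG
  have hfun : (fun q : Nat.Primes => calM2Factor c' χ (q : ℕ) (2 ^ a) (2 ^ b) s) =
      fun q : Nat.Primes => (if (q : ℕ) = 2 then calM2Factor c' χ 2 (2 ^ a) (2 ^ b) s else 1) * g q := by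
    funext q
    simp only [hg]
    by_cases hq : (q : ℕ) = 2
    · rw [if_pos hq, if_pos hq, mul_one, hq]
    · rw [if_neg hq, if_neg hq, one_mul]
      have hq2 : Nat.Coprime (q : ℕ) 2 := (Nat.coprime_primes q.prop Nat.prime_two).mpr hq
      exact calM2Factor_eq_one_one_of_coprime c' χ q.prop (hq2.pow_right a) (hq2.pow_right b) hs0
  unfold calM2
  rw [hfun]
  exact hprod.tprod_eq

/-- **`𝓜₂*(s) = c₂(s)·M₀(s)`** with `c₂ = F₂(1,1;s)` if `χ(2) ≠ 1` and `c₂ = 2` if `χ(2) = 1` (u026, and the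
splitting at `a = b = 0`). [cite: Zhang2022LandauSiegel, §16 p.92 (u026)] -/
theorem calM2star_eq {s : ℂ} (hs : 9 / 10 ≤ s.re) :
    calM2star c' χ s = (if χ (2 : ZMod D) ≠ 1 then calM2Factor c' χ 2 1 1 s else 2) *
      ∏' q : Nat.Primes, (if (q : ℕ) = 2 then (1 : ℂ) else calM2Factor c' χ (q : ℕ) 1 1 s) := by
  unfold calM2star
  split_ifs with h
  · have := calM2_two_pow_eq c' χ 0 0 hs
    simpa using this
  · rfl

/-- **The structure of `ϖ₂ⱼ(2^e)`**: if `𝓜₂*(1−β_j) ≠ 0` then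
`ϖ₂ⱼ(2^e) = (Σ_{a≤e} λ₂(2^a)(2^a)^{β_j}χ(2)^{e−a}F₂(2^a,2^{e−a};1−β_j)) / c₂`. The common odd Euler product
`M₀` cancels; no division by `F₂(1,1)` occurs when `χ(2) = 1` (reading F16B-1).
[cite: Zhang2022LandauSiegel, §16 p.93] -/
theorem varpi2_two_pow_eq (hstar : calM2star c' χ (1 - betaJ c' D j) ≠ 0) (e : ℕ) :
    varpi2 c' χ j (2 ^ e) =
      (∑ a ∈ Finset.range (e + 1), lam2 c' χ (2 ^ a) 1 * ((2 ^ a : ℕ) : ℂ) ^ betaJ c' D j *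
          χ (2 : ZMod D) ^ (e - a) * calM2Factor c' χ 2 (2 ^ a) (2 ^ (e - a)) (1 - betaJ c' D j)) /
        (if χ (2 : ZMod D) ≠ 1 then calM2Factor c' χ 2 1 1 (1 - betaJ c' D j) else 2) := by
  have hs : 9 / 10 ≤ (1 - betaJ c' D j).re := by rw [one_sub_betaJ_re]; norm_num
  set M0 : ℂ := ∏' q : Nat.Primes, (if (q : ℕ) = 2 then (1 : ℂ) else calM2Factor c' χ (q : ℕ) 1 1 (1 - betaJ c' D j))
    with hM0
  set c2 : ℂ := (if χ (2 : ZMod D) ≠ 1 then calM2Factor c' χ 2 1 1 (1 - betaJ c' D j) else 2) with hc2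
  have hstar' : calM2star c' χ (1 - betaJ c' D j) = c2 * M0 := calM2star_eq c' χ hs
  have hM00 : M0 ≠ 0 := by intro h; apply hstar; rw [hstar', h, mul_zero]
  have hc20 : c2 ≠ 0 := by intro h; apply hstar; rw [hstar', h, zero_mul]
  unfold varpi2
  rw [Nat.sum_divisorsAntidiagonal (fun x y => lam2 c' χ x 1 * (x : ℂ) ^ betaJ c' D j * χ (y : ZMod D) *
      calM2 c' χ x y (1 - betaJ c' D j) / calM2star c' χ (1 - betaJ c' D j)),
    Nat.divisors_prime_pow Nat.prime_two, Finset.sum_map, Finset.sum_div]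
  refine Finset.sum_congr rfl fun a ha => ?_
  have ha' : a ≤ e := Nat.lt_succ_iff.mp (Finset.mem_range.mp ha)
  simp only [Function.Embedding.coeFn_mk]
  rw [Nat.pow_div ha' two_pos, calM2_two_pow_eq c' χ a (e - a) hs, hstar', ← hM0, Nat.cast_pow, Nat.cast_pow,
    map_pow, Nat.cast_ofNat]
  field_simp
  ring

/-- **(H2): `‖ϖ₂ⱼ(2^e)‖ ≤ 2100(e+1)`** whenever `𝓜₂*(1−β_j) ≠ 0` and `|c₂| ≥ 1/2` (each summand has
`|λ₂| ≤ 3`, unimodular `2^{aβ_j}`, `|χ| ≤ 1`, `|F₂| ≤ 350`). [cite: Zhang2022LandauSiegel, §16 p.93] -/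
theorem norm_varpi2_two_pow_le [NeZero D] (hstar : calM2star c' χ (1 - betaJ c' D j) ≠ 0)
    (hc : 1 / 2 ≤ ‖(if χ (2 : ZMod D) ≠ 1 then calM2Factor c' χ 2 1 1 (1 - betaJ c' D j) else 2)‖) (e : ℕ) :
    ‖varpi2 c' χ j (2 ^ e)‖ ≤ 2100 * ((e : ℝ) + 1) := by
  have hs : 9 / 10 ≤ (1 - betaJ c' D j).re := by rw [one_sub_betaJ_re]; norm_num
  rw [varpi2_two_pow_eq c' χ j hstar e, norm_div, div_le_iff₀ (by linarith)]
  have hterm : ∀ a ∈ Finset.range (e + 1),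
      ‖lam2 c' χ (2 ^ a) 1 * ((2 ^ a : ℕ) : ℂ) ^ betaJ c' D j * χ (2 : ZMod D) ^ (e - a) *
          calM2Factor c' χ 2 (2 ^ a) (2 ^ (e - a)) (1 - betaJ c' D j)‖ ≤ 1050 := by
    intro a _
    have h1 : ‖lam2 c' χ (2 ^ a) 1‖ ≤ 3 := by
      rw [lam2_prime_pow c' χ Nat.prime_two a]
      split_ifs
      · rw [norm_one]; norm_num
      · exact Typed.Section16ACalM2.norm_lam2_prime_one_le c' χ Nat.prime_two
    have h2 := norm_prime_pow_cpow_betaJ c' (D := D) Nat.prime_two a j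
    have h3 : ‖χ (2 : ZMod D) ^ (e - a)‖ ≤ 1 := by
      rw [norm_pow]; exact pow_le_one₀ (norm_nonneg _) (χ.norm_le_one _)
    have h4 : ‖calM2Factor c' χ 2 (2 ^ a) (2 ^ (e - a)) (1 - betaJ c' D j)‖ ≤ 350 :=
      norm_calM2Factor_le c' χ Nat.prime_two _ _ hs
    rw [norm_mul, norm_mul, norm_mul, h2, mul_one]
    calc ‖lam2 c' χ (2 ^ a) 1‖ * ‖χ (2 : ZMod D) ^ (e - a)‖ *
          ‖calM2Factor c' χ 2 (2 ^ a) (2 ^ (e - a)) (1 - betaJ c' D j)‖ ≤ 3 * 1 * 350 := by gcongr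
      _ = 1050 := by norm_num
  calc _ ≤ ∑ a ∈ Finset.range (e + 1), ‖lam2 c' χ (2 ^ a) 1 * ((2 ^ a : ℕ) : ℂ) ^ betaJ c' D j *
        χ (2 : ZMod D) ^ (e - a) * calM2Factor c' χ 2 (2 ^ a) (2 ^ (e - a)) (1 - betaJ c' D j)‖ := norm_sum_le _ _
    _ ≤ ∑ a ∈ Finset.range (e + 1), (1050 : ℝ) := Finset.sum_le_sum hterm
    _ = 1050 * ((e : ℝ) + 1) := by simp; ring
    _ ≤ 2100 * ((e : ℝ) + 1) * ‖(if χ (2 : ZMod D) ≠ 1 then calM2Factor c' χ 2 1 1 (1 - betaJ c' D j) else 2)‖ := by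
        nlinarith [Nat.cast_nonneg (α := ℝ) e]

/-- **`ϖ₂ⱼ(2^e) = ϖ₂ⱼ^loc(2^e)` when `χ(2) ≠ 1`** (then `c₂ = F₂(1,1;1−β_j)` and `ϖ₂ⱼ(1) = 1`).
[cite: Zhang2022LandauSiegel, §16 p.93] -/
theorem varpi2_two_pow_eq_varpi2loc (hstar : calM2star c' χ (1 - betaJ c' D j) ≠ 0)
    (h2 : χ (2 : ZMod D) ≠ 1) (e : ℕ) : varpi2 c' χ j (2 ^ e) = varpi2loc c' χ j (2 ^ e) := by
  rw [varpi2_two_pow_eq c' χ j hstar e, if_pos h2]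
  rcases Nat.eq_zero_or_pos e with rfl | he
  · rw [pow_zero, varpi2loc_one, Finset.sum_range_one]
    simp only [Nat.sub_self, pow_zero, Nat.cast_one, one_cpow, mul_one]
    have hl1 : lam2 c' χ 1 1 = 1 := by unfold lam2; rw [Nat.primeFactors_one, Finset.prod_empty]
    rw [hl1, one_mul]
    have hs : 9 / 10 ≤ (1 - betaJ c' D j).re := by rw [one_sub_betaJ_re]; norm_num
    have hF : calM2Factor c' χ 2 1 1 (1 - betaJ c' D j) ≠ 0 := by
      intro h0
      apply hstar
      rw [calM2star_eq c' χ hs, if_pos h2, h0, zero_mul]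
    exact div_self hF
  rw [varpi2loc_prime_pow c' χ Nat.prime_two he.ne' j, Finset.sum_div]
  refine Finset.sum_congr rfl fun a _ => ?_
  unfold locRatio
  push_cast
  ring

end Split

/-! ## §2. The case `χ(2) = 1`: the factor at `2` against the model `3/8` -/

section TwoSplit

variable (c' : ℝ) {D : ℕ} (χ : DirichletCharacter ℂ D) (j : ℕ)

/-- `‖w^a − 1‖ ≤ a‖w − 1‖` for `‖w‖ ≤ 1`. [folklore] -/
private theorem norm_pow_sub_one_le' {w : ℂ} (hw : ‖w‖ ≤ 1) (a : ℕ) : ‖w ^ a - 1‖ ≤ a * ‖w - 1‖ := by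
  induction a with
  | zero => simp
  | succ a ih =>
    rw [show w ^ (a + 1) - 1 = w * (w ^ a - 1) + (w - 1) by ring]
    calc _ ≤ ‖w‖ * ‖w ^ a - 1‖ + ‖w - 1‖ := by rw [← norm_mul]; exact norm_add_le _ _
      _ ≤ 1 * (a * ‖w - 1‖) + ‖w - 1‖ := by gcongr
      _ = ((a + 1 : ℕ) : ℝ) * ‖w - 1‖ := by push_cast; ring

/-- `((2^a))^{β} = (2^{β})^a`. [folklore] -/
private theorem two_pow_cpow (a : ℕ) (s : ℂ) : ((2 ^ a : ℕ) : ℂ) ^ s = ((2 : ℂ) ^ s) ^ a := by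
  induction a with
  | zero => simp
  | succ a ih =>
    rw [pow_succ, Nat.cast_mul, Complex.natCast_mul_natCast_cpow, ih, pow_succ]; norm_num

/-- **The coefficient at `2^e` against the model `e·C(e+2,2)`** (`χ(2) = 1`, `𝓜₂*(1−β_j) ≠ 0`):
`‖ϖ₂ⱼ(2^e)(ν∗χ)(2^e) − e·C(e+2,2)‖ ≤ 2675(e+1)⁴δ₂`, `δ₂ = ‖2^{−β₁} − 1‖ + ‖2^{β_j} − 1‖`
(`ϖ₂ⱼ(2^e) = ½Σ_a λ₂(2^a)2^{aβ_j}F₂(2^a,2^{e−a})`, model `½Σ_a F⁰₂(e−a) = e` since `F⁰₂(b) = 2·𝟙[b ≥ 1]`).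
[cite: Zhang2022LandauSiegel, §16 p.93, App. A p.106] -/
theorem norm_coeff_two_sub_model_le (hstar : calM2star c' χ (1 - betaJ c' D j) ≠ 0) (h1 : χ (2 : ZMod D) = 1)
    (e : ℕ) :
    ‖varpi2 c' χ j (2 ^ e) * nuConvChi χ (2 ^ e) - (e : ℂ) * ((e + 2).choose 2 : ℂ)‖ ≤
      2675 * ((e : ℝ) + 1) ^ 4 * (‖(2 : ℂ) ^ (-beta1 c' D) - 1‖ + ‖(2 : ℂ) ^ betaJ c' D j - 1‖) := by
  set δ : ℝ := ‖(2 : ℂ) ^ (-beta1 c' D) - 1‖ + ‖(2 : ℂ) ^ betaJ c' D j - 1‖ with hδ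
  have hδ0 : 0 ≤ δ := by positivity
  have hs : 9 / 10 ≤ (1 - betaJ c' D j).re := by rw [one_sub_betaJ_re]; norm_num
  have h1' : χ ((2 : ℕ) : ZMod D) = 1 := by simpa using h1
  rw [varpi2_two_pow_eq c' χ j hstar e, if_neg (not_not.mpr h1), h1,
    nuConvChi_prime_pow_of_apply_eq_one χ Nat.prime_two h1' e]
  -- the model: `Σ_a F⁰(e−a) = 2e`
  set F0 : ℕ → ℂ := fun a => (1 - (1 : ℂ) / (2 : ℂ))⁻¹ *
    (1 - (if Nat.Coprime 2 (2 ^ (e - a)) then (1 : ℂ) else 0) * ((1 : ℂ) / ((2 : ℂ) - 1))) with hF0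
  have hF0v : ∀ a ∈ Finset.range (e + 1), F0 a = if a = e then 0 else 2 := by
    intro a ha
    have ha' : a ≤ e := Nat.lt_succ_iff.mp (Finset.mem_range.mp ha)
    simp only [hF0]
    by_cases hae : a = e
    · rw [if_pos hae, hae, Nat.sub_self, pow_zero, if_pos (Nat.coprime_one_right 2)]; norm_num
    · have hne : ¬ Nat.Coprime 2 (2 ^ (e - a)) := by
        rw [Nat.Prime.coprime_iff_not_dvd Nat.prime_two]; push Not
        exact dvd_pow_self 2 (by omega)
      rw [if_neg hae, if_neg hne]; norm_num
  have hmodel : ∑ a ∈ Finset.range (e + 1), F0 a = 2 * e := by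
    rw [Finset.sum_congr rfl hF0v, Finset.sum_ite, Finset.sum_const_zero, zero_add, Finset.sum_const,
      Finset.filter_ne', Finset.card_erase_of_mem (Finset.self_mem_range_succ e), Finset.card_range]
    simp; ring
  -- termwise comparison
  have hterm : ∀ a ∈ Finset.range (e + 1),
      ‖lam2 c' χ (2 ^ a) 1 * ((2 ^ a : ℕ) : ℂ) ^ betaJ c' D j * (1 : ℂ) ^ (e - a) *
          calM2Factor c' χ 2 (2 ^ a) (2 ^ (e - a)) (1 - betaJ c' D j) - F0 a‖ ≤ 5350 * ((e : ℝ) + 1) * δ := by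
    intro a ha
    have ha' : a ≤ e := Nat.lt_succ_iff.mp (Finset.mem_range.mp ha)
    set wa : ℂ := ((2 ^ a : ℕ) : ℂ) ^ betaJ c' D j with hwa
    set la : ℂ := lam2 c' χ (2 ^ a) 1 with hla
    set Fa : ℂ := calM2Factor c' χ 2 (2 ^ a) (2 ^ (e - a)) (1 - betaJ c' D j) with hFa
    have hwan : ‖wa‖ = 1 := norm_prime_pow_cpow_betaJ c' (D := D) Nat.prime_two a j
    have hwa1 : ‖wa - 1‖ ≤ e * δ := by
      rw [hwa, two_pow_cpow]
      have hw : ‖(2 : ℂ) ^ betaJ c' D j‖ ≤ 1 := by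
        have := norm_prime_pow_cpow_betaJ c' (D := D) Nat.prime_two 1 j
        rw [pow_one] at this; push_cast at this; exact this.le
      have hie : (a : ℝ) ≤ e := by exact_mod_cast ha'
      have hwδ : ‖(2 : ℂ) ^ betaJ c' D j - 1‖ ≤ δ := by rw [hδ]; linarith [norm_nonneg ((2 : ℂ) ^ (-beta1 c' D) - 1)]
      calc _ ≤ (a : ℝ) * ‖(2 : ℂ) ^ betaJ c' D j - 1‖ := norm_pow_sub_one_le' hw a
        _ ≤ e * δ := mul_le_mul hie hwδ (norm_nonneg _) (Nat.cast_nonneg e)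
    have hla1 : ‖la - 1‖ ≤ δ := by
      rw [hla, lam2_prime_pow c' χ Nat.prime_two a]
      split_ifs
      · simp; exact hδ0
      · have := norm_lam2_one_sub_one_le' c' χ (D := D) Nat.prime_two
        push_cast at this
        calc _ ≤ 2 * ‖(2 : ℂ) ^ (-beta1 c' D) - 1‖ / 2 := this
          _ ≤ δ := by rw [hδ]; linarith [norm_nonneg ((2 : ℂ) ^ betaJ c' D j - 1)]
    have hFan : ‖Fa‖ ≤ 350 := norm_calM2Factor_le c' χ Nat.prime_two _ _ hs
    have hFa0 : ‖Fa - F0 a‖ ≤ 5000 * δ := by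
      have := norm_calM2Factor_sub_model_le c' χ j Nat.prime_two (2 ^ a) (2 ^ (e - a))
      rw [h1'] at this
      push_cast at this
      simpa [hFa, hF0] using this
    rw [one_pow, mul_one, show la * wa * Fa - F0 a = (la - 1) * wa * Fa + (wa - 1) * Fa + (Fa - F0 a) by ring]
    calc _ ≤ ‖(la - 1) * wa * Fa‖ + ‖(wa - 1) * Fa‖ + ‖Fa - F0 a‖ := by
          refine (norm_add_le _ _).trans (add_le_add (norm_add_le _ _) le_rfl)
      _ ≤ δ * 1 * 350 + (e * δ) * 350 + 5000 * δ := by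
          rw [norm_mul, norm_mul, norm_mul, hwan]; gcongr
      _ ≤ 5350 * ((e : ℝ) + 1) * δ := by nlinarith [Nat.cast_nonneg (α := ℝ) e]
  have hsum : ‖∑ a ∈ Finset.range (e + 1), (lam2 c' χ (2 ^ a) 1 * ((2 ^ a : ℕ) : ℂ) ^ betaJ c' D j *
      (1 : ℂ) ^ (e - a) * calM2Factor c' χ 2 (2 ^ a) (2 ^ (e - a)) (1 - betaJ c' D j) - F0 a)‖
        ≤ (e + 1) * (5350 * ((e : ℝ) + 1) * δ) := by
    calc _ ≤ ∑ a ∈ Finset.range (e + 1), ‖lam2 c' χ (2 ^ a) 1 * ((2 ^ a : ℕ) : ℂ) ^ betaJ c' D j *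
          (1 : ℂ) ^ (e - a) * calM2Factor c' χ 2 (2 ^ a) (2 ^ (e - a)) (1 - betaJ c' D j) - F0 a‖ := norm_sum_le _ _
      _ ≤ ∑ a ∈ Finset.range (e + 1), 5350 * ((e : ℝ) + 1) * δ := Finset.sum_le_sum hterm
      _ = (e + 1) * (5350 * ((e : ℝ) + 1) * δ) := by simp
  -- `Σ/2 · a − e·a = ((Σ − 2e)/2)·a`
  have hid : (∑ a ∈ Finset.range (e + 1), lam2 c' χ (2 ^ a) 1 * ((2 ^ a : ℕ) : ℂ) ^ betaJ c' D j *
      (1 : ℂ) ^ (e - a) * calM2Factor c' χ 2 (2 ^ a) (2 ^ (e - a)) (1 - betaJ c' D j)) / 2 * ((e + 2).choose 2 : ℂ) -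
      (e : ℂ) * ((e + 2).choose 2 : ℂ) =
      (∑ a ∈ Finset.range (e + 1), (lam2 c' χ (2 ^ a) 1 * ((2 ^ a : ℕ) : ℂ) ^ betaJ c' D j *
        (1 : ℂ) ^ (e - a) * calM2Factor c' χ 2 (2 ^ a) (2 ^ (e - a)) (1 - betaJ c' D j) - F0 a)) / 2 *
        ((e + 2).choose 2 : ℂ) := by
    rw [Finset.sum_sub_distrib, hmodel]; ring
  rw [hid, norm_mul, norm_div, Complex.norm_two]
  have hC2 : ‖((e + 2).choose 2 : ℂ)‖ ≤ ((e : ℝ) + 1) ^ 2 := by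
    rw [Nat.cast_choose_two, norm_div, Complex.norm_two]
    have : ‖(((e + 2 : ℕ) : ℂ)) * (((e + 2 : ℕ) : ℂ) - 1)‖ = ((e : ℝ) + 2) * ((e : ℝ) + 1) := by
      rw [norm_mul]; push_cast
      rw [show ((e : ℂ) + 2 - 1) = ((e + 1 : ℝ) : ℂ) by push_cast; ring, show ((e : ℂ) + 2) = ((e + 2 : ℝ) : ℂ) by push_cast; ring,
        Complex.norm_real, Complex.norm_real, Real.norm_eq_abs, Real.norm_eq_abs,
        abs_of_nonneg (by positivity), abs_of_nonneg (by positivity)]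
    rw [this, div_le_iff₀ (by norm_num : (0:ℝ) < 2)]
    nlinarith [Nat.cast_nonneg (α := ℝ) e]
  calc _ ≤ ((e + 1) * (5350 * ((e : ℝ) + 1) * δ)) / 2 * ((e : ℝ) + 1) ^ 2 := by gcongr
    _ = 2675 * ((e : ℝ) + 1) ^ 4 * δ := by ring

/-- **The Euler factor of `E₂ⱼ` at `2`, `s = 1`, against `3/8`** (`χ(2) = 1`, `𝓜₂*(1−β_j) ≠ 0`):
`‖N₂(½)·Σ_e ϖ₂ⱼ(2^e)(ν∗χ)(2^e)2^{−e} − 3/8‖ ≤ 6·10⁸·δ₂`, where `3/8 = (1/2)⁶·Σ_e e·C(e+2,2)2^{−e} = (1 − ¼)/2`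
is the factor at `2` of `(6/π²)/𝔭` with `𝔭 = 2∏_{q>2}(…)`. [cite: Zhang2022LandauSiegel, §16 Lemma 16.2 p.94] -/
theorem norm_Phi_two_one_sub_model_le (hstar : calM2star c' χ (1 - betaJ c' D j) ≠ 0) (h1 : χ (2 : ZMod D) = 1) :
    ‖(1 - (2 : ℂ) ^ (-(1 : ℂ))) ^ 2 * (1 - (2 : ℂ) ^ betaJ c' D j * (2 : ℂ) ^ (-(1 : ℂ))) *
          (1 - χ (2 : ZMod D) * (2 : ℂ) ^ (-(1 : ℂ))) * (1 - χ (2 : ZMod D) * ((2 : ℂ) ^ betaJ c' D j * (2 : ℂ) ^ (-(1 : ℂ)))) ^ 2 *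
        (∑' e : ℕ, varpi2 c' χ j (2 ^ e) * nuConvChi χ (2 ^ e) * ((2 : ℂ) ^ (-(1 : ℂ))) ^ e) - 3 / 8‖
      ≤ 600000000 * (‖(2 : ℂ) ^ (-beta1 c' D) - 1‖ + ‖(2 : ℂ) ^ betaJ c' D j - 1‖) := by
  set δ : ℝ := ‖(2 : ℂ) ^ (-beta1 c' D) - 1‖ + ‖(2 : ℂ) ^ betaJ c' D j - 1‖ with hδ
  have hδ0 : 0 ≤ δ := by positivity
  set y : ℂ := (2 : ℂ) ^ (-(1 : ℂ)) with hydef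
  have hyq : y = 1 / 2 := by rw [hydef, Complex.cpow_neg_one]; norm_num
  have hyn : ‖y‖ = 1 / 2 := by rw [hyq]; norm_num
  have hyh : ‖y‖ ≤ 1 / 2 := hyn.le
  have hy35 : ‖y‖ ≤ 3 / 5 := by rw [hyn]; norm_num
  have hy1 : ‖y‖ < 1 := by rw [hyn]; norm_num
  set w : ℂ := (2 : ℂ) ^ betaJ c' D j with hwdef
  have hw : ‖w‖ = 1 := by
    have := norm_prime_pow_cpow_betaJ c' (D := D) Nat.prime_two 1 j
    rw [pow_one] at this; push_cast at this; exact this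
  rw [h1]
  -- the coefficient comparison
  set c : ℕ → ℂ := fun e => varpi2 c' χ j (2 ^ e) * nuConvChi χ (2 ^ e) with hcdef
  set c0 : ℕ → ℂ := fun e => (e : ℂ) * ((e + 2).choose 2 : ℂ) with hc0def
  have hd : ∀ e, ‖(c e - c0 e) * y ^ e‖ ≤ 2675 * δ * (((e : ℝ) + 2) ^ 4 * (1 / 2 : ℝ) ^ e) := fun e => by
    rw [norm_mul, norm_pow, hyn]
    have h1 : ‖c e - c0 e‖ ≤ 2675 * ((e : ℝ) + 1) ^ 4 * δ := norm_coeff_two_sub_model_le c' χ j hstar h1 e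
    have h2 : ((e : ℝ) + 1) ^ 4 ≤ ((e : ℝ) + 2) ^ 4 := by gcongr; linarith
    calc ‖c e - c0 e‖ * (1 / 2 : ℝ) ^ e ≤ (2675 * ((e : ℝ) + 1) ^ 4 * δ) * (1 / 2 : ℝ) ^ e := by gcongr
      _ ≤ (2675 * ((e : ℝ) + 2) ^ 4 * δ) * (1 / 2 : ℝ) ^ e := by gcongr
      _ = _ := by ring
  obtain ⟨hqs, hqle⟩ := tsum_quartic_half_le'
  have hmaj : Summable fun e : ℕ => 2675 * δ * (((e : ℝ) + 2) ^ 4 * (1 / 2 : ℝ) ^ e) := hqs.mul_left _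
  have hsd : Summable fun e : ℕ => (c e - c0 e) * y ^ e := Summable.of_norm_bounded hmaj hd
  have hdiff : ‖∑' e : ℕ, (c e - c0 e) * y ^ e‖ ≤ 2675 * δ * 12288 := by
    calc _ ≤ ∑' e : ℕ, ‖(c e - c0 e) * y ^ e‖ := norm_tsum_le_tsum_norm hsd.norm
      _ ≤ ∑' e : ℕ, 2675 * δ * (((e : ℝ) + 2) ^ 4 * (1 / 2 : ℝ) ^ e) := Summable.tsum_le_tsum hd hsd.norm hmaj
      _ = 2675 * δ * ∑' e : ℕ, ((e : ℝ) + 2) ^ 4 * (1 / 2 : ℝ) ^ e := tsum_mul_left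
      _ ≤ 2675 * δ * 12288 := by gcongr
  -- the model series `Σ e·C(e+2,2) yᵉ = 3y/(1−y)⁴`
  have S3' : HasSum (fun n : ℕ => ((n + 3).choose 3 : ℂ) * y ^ n * y) (1 / (1 - y) ^ 4 * y) :=
    (hasSum_choose_mul_geometric_of_norm_lt_one 3 hy1).mul_right y
  have S3 : HasSum (fun e : ℕ => ((e + 2).choose 3 : ℂ) * y ^ e) (1 / (1 - y) ^ 4 * y) := by
    rw [← hasSum_nat_add_iff' 1]
    rw [Finset.sum_range_one, Nat.choose_eq_zero_of_lt (by norm_num : 0 + 2 < 3), Nat.cast_zero, zero_mul, sub_zero]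
    refine S3'.congr_fun fun n => ?_
    rw [show n + 1 + 2 = n + 3 by ring, pow_succ, mul_assoc]
  have S0 : HasSum (fun e : ℕ => c0 e * y ^ e) (3 * (1 / (1 - y) ^ 4 * y)) := by
    refine (S3.mul_left 3).congr_fun fun e => ?_
    rw [hc0def]; dsimp only
    have h3 : ((e + 2).choose 3 : ℂ) * 3 = ((e + 2).choose 2 : ℂ) * e := by
      have := Nat.choose_succ_right_eq (e + 2) 2
      rw [show e + 2 - 2 = e by omega] at this
      exact_mod_cast this
    linear_combination (-(y ^ e)) * h3
  have hc0n : ∀ e, ‖c0 e‖ ≤ 1 * ((e : ℝ) + 1) ^ 3 := by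
    intro e
    rw [hc0def]; dsimp only
    rw [norm_mul, Complex.norm_natCast, Nat.cast_choose_two, norm_div, Complex.norm_two]
    have : ‖(((e + 2 : ℕ) : ℂ)) * (((e + 2 : ℕ) : ℂ) - 1)‖ = ((e : ℝ) + 2) * ((e : ℝ) + 1) := by
      rw [norm_mul]; push_cast
      rw [show ((e : ℂ) + 2 - 1) = ((e + 1 : ℝ) : ℂ) by push_cast; ring, show ((e : ℂ) + 2) = ((e + 2 : ℝ) : ℂ) by push_cast; ring,
        Complex.norm_real, Complex.norm_real, Real.norm_eq_abs, Real.norm_eq_abs,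
        abs_of_nonneg (by positivity), abs_of_nonneg (by positivity)]
    rw [this]
    have he := Nat.cast_nonneg (α := ℝ) e
    rw [mul_div_assoc', div_le_iff₀ (by norm_num : (0:ℝ) < 2)]
    nlinarith [mul_nonneg he he, mul_nonneg (mul_nonneg he he) he]
  have hC0n : ‖∑' e : ℕ, c0 e * y ^ e‖ ≤ 240 * 1 := norm_tsum_coeff_mul_pow_le'' hc0n hy35
  have hsc0 : Summable fun e : ℕ => c0 e * y ^ e := S0.summable
  have hsc : Summable fun e : ℕ => c e * y ^ e := by
    have := hsc0.add hsd
    refine this.congr fun e => ?_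
    ring
  -- sizes of `N`
  have hv1 : ‖(1 : ℂ)‖ ≤ 1 := by simp
  obtain ⟨hN, -⟩ := norm_normPoly_le (v := (1 : ℂ)) hy35 hw hv1
  have hNN := norm_normPoly_sub_model_le (v := (1 : ℂ)) hyh hw hv1
  set N : ℂ := (1 - y) ^ 2 * (1 - w * y) * (1 - 1 * y) * (1 - 1 * (w * y)) ^ 2 with hNdef
  set N0 : ℂ := (1 - y) ^ 2 * (1 - 1 * y) * (1 - 1 * y) * (1 - 1 * (1 * y)) ^ 2 with hN0def
  set C : ℂ := ∑' e : ℕ, c e * y ^ e with hCdef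
  set C0 : ℂ := ∑' e : ℕ, c0 e * y ^ e with hC0def
  -- the model value `N0·C0 = 3/8`
  have hmodel : N0 * C0 = 3 / 8 := by
    rw [hC0def, S0.tsum_eq, hN0def, hyq]; norm_num
  have hCC : ‖C - C0‖ ≤ 2675 * δ * 12288 := by
    rw [hCdef, hC0def, ← hsc.tsum_sub hsc0]
    have : ∑' e : ℕ, (c e * y ^ e - c0 e * y ^ e) = ∑' e : ℕ, (c e - c0 e) * y ^ e :=
      tsum_congr fun e => by ring
    rw [this]; exact hdiff
  show ‖N * C - 3 / 8‖ ≤ 600000000 * δ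
  rw [← hmodel, show N * C - N0 * C0 = N * (C - C0) + (N - N0) * C0 by ring]
  have hw1 : ‖w - 1‖ ≤ δ := by rw [hδ]; linarith [norm_nonneg ((2 : ℂ) ^ (-beta1 c' D) - 1)]
  calc ‖N * (C - C0) + (N - N0) * C0‖ ≤ ‖N‖ * ‖C - C0‖ + ‖N - N0‖ * ‖C0‖ := by
        rw [← norm_mul, ← norm_mul]; exact norm_add_le _ _
    _ ≤ 17 * (2675 * δ * 12288) + (25 * ‖w - 1‖ * ‖y‖) * (240 * 1) := by gcongr
    _ ≤ 600000000 * δ := by rw [hyn]; nlinarith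

end TwoSplit

end Literature.NumberTheory.LFunctions.Zhang2022.Lemma162R

end
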